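/-
Copyright (c) 2026 the pub-hodgecm-mathlib formalisation cell (harness21).  Prover seat hodgecm-mathlib-K2E1-p09 (g6), Track B ∕ K2-LIT, h413 =
`stmt-HodgeConjecture-24833`, ENGINE E1, campaign «EIS-R7-BL-SPH-2», deal «BL-P3 FILE C» of the dealer K2E1-plan (g5) (ORDER 2026-09-04T09:18:31Z (a) + (b)).
-/
import Summits.HodgeConjecture.HodgeConjecture.Theorems.K2E1BLHeckeOperatorHXU2    -- ★ (this seat) FILE C part 1: `w₁` facts, the `𝔛`-side Tonelli bound, a.e. congruence ∕ integrability; brings P3 A∕B1∕B2 + leaves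
import HarnessLib

/-!
# K2·E1 — `K2E1BLHeckeOperatorHXU2Op` («EIS-R7-BL-SPH-2», P3 FILE C, part 2): THE OPERATOR `T_X = R(h)` ON `𝓗_k(𝔛)` WITH `‖T_X u‖ ≤ κ^k‖h‖₁‖u‖`, AND THE INTERTWINING
# `δ(h) ∘ ι = restr ∘ ι ∘ T_X` WITH BERNSTEIN–LAPID'S `ι : 𝓗_k(𝔛) → 𝓗_k(Z_c)` AND `δ(h) : 𝓗_k(Z_c) → 𝓗_k(Z_{c₀})`

Track B ∕ K2-LIT, crux h413 = `stmt-HodgeConjecture-24833`, route of record `HCCMUnconditional`; cell `hodgecm-mathlib`, squad K2, ENGINE E1 (campaign «EIS-R7-BL», (ζ′) WIRING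
7d1cceb628a30de8 §3 P3∕P8; dealer 09:18:31Z (a) `exists_shiftOperatorX`, (b) «the INTERTWINING `deltaShift hs ∘L iota hb = restrHN h ∘L iota hb ∘L T_X` (pullback along `pZX`
commutes with right convolution + a.e. glue)» = the letter `hδι : δ i ∘L ι = r i ∘L ι ∘L T i` of ★ G-c `K2E1BLXSystemPackage`).  Prover seat `hodgecm-mathlib-K2E1-p09` (g6).
THEOREMS ONLY (no `def`, no `instance`, no notation, no named-fact hypothesis, no `sorry`; default heartbeats); lane `--supports stmt-HodgeConjecture-24833 --as helper`
(count-neutral).  Closes no socket.  RANK-GENERIC.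

THE MATHEMATICS [BernsteinLapid2019, §4 p. 10 (Claim 4); Folland1999, Thm. 6.18].  (a) With `μX_w := w₁^{−2k}·μ` (`𝓗_k(𝔛) = L²(μX_w)`, ★ D5 `HX`), `μ` invariant
(`SMulInvariantMeasure`, e.g. ★ `IsAutomorphicMeasure`) and s-finite, `h` measurable integrable `= 0` off a compact `Ω`: `u ↦ [R(h)u]`, `(R(h)u)(ξ) = ∫ h(y)u(y⁻¹•ξ) dν`, is a well
defined (★ part 1 §5: respects a.e.-equality; integrands a.e. integrable) BOUNDED LINEAR map `T_X : 𝓗_k(𝔛) → 𝓗_k(𝔛)` with `T_X u =ᵐ R(h)u` and `‖T_X u‖ ≤ κ^k‖h‖₁‖u‖` (★ part 1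
§4).  (b) THE INTERTWINING: `p : Z → 𝔛`, `B(F)g ↦ [g⁻¹]` (★ `pZX`) satisfies **`p(z·y) = y⁻¹ • p(z)`**, so POINTWISE `R_Z(h)(u ∘ p) = (R_X(h)u) ∘ p`; with the a.e. formulas of
★ `deltaShift`, ★ `coeFn_iota`, `T_X`, the a.e.-congruence of `R_Z(h)` (★ B1 `rightConvFun_congr_ae_restrict`), the quasi-measure-preservation clause of ★ `IotaBound` (a.e. on `𝔛`
pulls back along `p`) and `w_{k,c₀} ≪ w_{k,c₁}`: both `δ(h)(ι u)` and `restr(ι(T_X u))` are a.e. `(R_X(h)u) ∘ p` on `Z_{c₀}`, hence EQUAL in `𝓗_k(Z_{c₀})` for every `u`: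
  **`deltaShift hs ∘L iota hb = restrHN h01 ∘L iota hb ∘L T_X`** for ANY `T_X` with `T_X u =ᵐ R(h)u` (in particular the one of (a)).

* §1 `ae_withDensity_weightX_iff`, `eLpNorm_two_withDensity_weightX`, `measurable_convX`, **`eLpNorm_convX_le`**, `memLp_convX`.
* §2 **`exists_shiftOperatorX`** — `∃ T_X : HX k μ →L[ℂ] HX k μ, (∀ u, T_X u =ᵐ[μX_w] R(h)u) ∧ ∀ u, ‖T_X u‖ ≤ κ^k·(∫⁻‖h‖ₑ).toReal·‖u‖`; `exists_shiftOperatorX_of_isCompact`.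
* §3 `pZX_rightShift` (`p(z·y) = y⁻¹•p(z)`), `rightConvFun_comp_pZX` (pointwise intertwining), **`deltaShift_comp_iota`** (THE INTERTWINING, letter `hδι`).
HONEST LABEL: HC_CM is proved only modulo the 7 printed citations (2 remaining named inputs: hLiu418 = `stmt-HodgeConjecture-24832`, h413 = `stmt-HodgeConjecture-24833`) until rung 0
closes; this file asserts no named fact and closes no socket; count-neutral.  Letters remaining by design: `hright` (P2a-ι §4bis), `IotaBound` (★ P2a-ι at N = 2), s-finiteness.

## References
* [BernsteinLapid2019] J. Bernstein, E. Lapid, *On the meromorphic continuation of Eisenstein series*, J. Amer. Math. Soc. 37 (2024) (arXiv:1911.02342): §4 p. 10, Claim 4.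
* [Folland1999] G. B. Folland, *Real Analysis* (2nd ed., 1999): Thm. 6.18.
-/

set_option autoImplicit false
set_option linter.dupNamespace false  -- the mandated namespace repeats the summit's segment (`HodgeConjecture.HodgeConjecture`)

noncomputable section

open MeasureTheory NumberField IsDedekindDomain Filter Topology Set
open scoped NNReal ENNReal
open Literature.NumberTheory.Automorphic Literature.NumberTheory.Automorphic.UnitaryGroup AdelicGroupData
open Summit.HodgeConjecture.HodgeConjecture.Cruxes.H413.K2E1BLBorelSpacesU2Defs
open Summit.HodgeConjecture.HodgeConjecture.Cruxes.H413.K2E1BLBorelOperatorsU2Defs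
open Summit.HodgeConjecture.HodgeConjecture.Cruxes.H413.K2E1BLHeckeOperatorWeightedU2
open Summit.HodgeConjecture.HodgeConjecture.Cruxes.H413.K2E1BLRightConvTonelliU2 (rightConvFun_congr_ae_restrict)
open Summit.HodgeConjecture.HodgeConjecture.Cruxes.H413.K2E1BLShiftBoundU2 (ae_weightedTruncMeasure_iff)
open Summit.HodgeConjecture.HodgeConjecture.Cruxes.H413.K2E1BLHeckeOperatorHXU2

namespace Summit.HodgeConjecture.HodgeConjecture.Cruxes.H413.K2E1BLHeckeOperatorHXU2Op

variable {F E : Type} [Field F] [NumberField F] [Field E] [NumberField E] [Algebra F E] {c : E ≃ₐ[F] E} {N : ℕ} [NeZero N]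

/-! ## §1 The weighted measure on `𝔛`, and `R(h)u ∈ 𝓗_k(𝔛)` with the norm bound -/

section Estimate

variable [MeasurableSpace (quasiSplit F E c N).Adelic] [BorelSpace (quasiSplit F E c N).Adelic]
  (νG : Measure (quasiSplit F E c N).Adelic) (μ : Measure (quasiSplit F E c N).automorphicQuotient) (k : ℕ)

omit [MeasurableSpace (quasiSplit F E c N).Adelic] [BorelSpace (quasiSplit F E c N).Adelic] in
/-- a.e. for `μX_w = w₁^{−2k}·μ` is a.e. for `μ` (the density never vanishes). [cite: BernsteinLapid2019, §4 p. 10] -/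
theorem ae_withDensity_weightX_iff {p : (quasiSplit F E c N).automorphicQuotient → Prop} :
    (∀ᵐ ξ ∂(μ.withDensity fun x => (((supHeight F E c N x)⁻¹ ^ (2 * k) : ℝ≥0) : ℝ≥0∞)), p ξ) ↔ ∀ᵐ ξ ∂μ, p ξ := by
  rw [ae_withDensity_iff (measurable_weightX k)]
  have hW : ∀ ξ : (quasiSplit F E c N).automorphicQuotient, ((((supHeight F E c N ξ)⁻¹ ^ (2 * k) : ℝ≥0)) : ℝ≥0∞) ≠ 0 := fun ξ => by
    exact_mod_cast (pow_pos (inv_pos.2 (supHeight_pos ξ)) _).ne'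
  exact ⟨fun h => h.mono fun ξ hξ => hξ (hW ξ), fun h => h.mono fun ξ hξ _ => hξ⟩

omit [MeasurableSpace (quasiSplit F E c N).Adelic] [BorelSpace (quasiSplit F E c N).Adelic] in
/-- `eLpNorm g 2 μX_w = (∫⁻ W·‖g‖ₑ² dμ)^{1∕2}` for measurable `g`. [cite: MoeglinWaldspurger1995, I.2.13] -/
theorem eLpNorm_two_withDensity_weightX {g : (quasiSplit F E c N).automorphicQuotient → ℂ} (hg : Measurable g) :
    eLpNorm g 2 (μ.withDensity fun x => (((supHeight F E c N x)⁻¹ ^ (2 * k) : ℝ≥0) : ℝ≥0∞)) =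
      (∫⁻ ξ, ((((supHeight F E c N ξ)⁻¹ ^ (2 * k) : ℝ≥0)) : ℝ≥0∞) * ‖g ξ‖ₑ ^ 2 ∂μ) ^ (1 / 2 : ℝ) := by
  rw [eLpNorm_eq_lintegral_rpow_enorm_toReal two_ne_zero ENNReal.ofNat_ne_top, ENNReal.toReal_ofNat,
    lintegral_withDensity_eq_lintegral_mul _ (measurable_weightX k) (hg.enorm.pow_const _)]
  congr 2
  funext ξ
  rw [Pi.mul_apply, show (2 : ℝ) = ((2 : ℕ) : ℝ) by norm_num, ENNReal.rpow_natCast]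

omit [NeZero N] in
/-- `R(h)u` is measurable (jointly measurable integrand, ★ `measurable_inv_smul_uncurry`). [cite: Folland1999, Thm. 2.37] -/
theorem measurable_convX [SFinite νG] {h : (quasiSplit F E c N).Adelic → ℂ} (hhm : Measurable h) {u : (quasiSplit F E c N).automorphicQuotient → ℂ} (hu : Measurable u) :
    Measurable fun ξ : (quasiSplit F E c N).automorphicQuotient => ∫ y, h y * u (y⁻¹ • ξ) ∂νG := by
  have hF : StronglyMeasurable (Function.uncurry fun (ξ : (quasiSplit F E c N).automorphicQuotient) (y : (quasiSplit F E c N).Adelic) => h y * u (y⁻¹ • ξ)) :=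
    ((hhm.comp measurable_snd).mul (hu.comp measurable_inv_smul_uncurry)).stronglyMeasurable
  exact (hF.integral_prod_right (ν := νG)).measurable

variable [SMulInvariantMeasure (quasiSplit F E c N).Adelic (quasiSplit F E c N).automorphicQuotient μ]

/-- **`eLpNorm (R(h)u) 2 μX_w ≤ κ^k·(∫⁻‖h‖ₑ)·eLpNorm u 2 μX_w`** (★ part 1 §4 read through §1). [cite: BernsteinLapid2019, §4 p. 10] [cite: Folland1999, Thm. 6.18] -/
theorem eLpNorm_convX_le [SFinite νG] [SFinite μ] {Ω : Set (quasiSplit F E c N).Adelic} {κ : ℝ≥0}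
    (hΩ : ∀ ξ : (quasiSplit F E c N).automorphicQuotient, ∀ y ∈ Ω, supHeight F E c N (y⁻¹ • ξ) ≤ κ * supHeight F E c N ξ ∧ supHeight F E c N ξ ≤ κ * supHeight F E c N (y⁻¹ • ξ))
    {h : (quasiSplit F E c N).Adelic → ℂ} (hhm : Measurable h) (hh1 : ∫⁻ y, ‖h y‖ₑ ∂νG ≠ ∞) (hsupp : ∀ y, y ∉ Ω → h y = 0)
    {u : (quasiSplit F E c N).automorphicQuotient → ℂ} (hu : Measurable u) :
    eLpNorm (fun ξ => ∫ y, h y * u (y⁻¹ • ξ) ∂νG) 2 (μ.withDensity fun x => (((supHeight F E c N x)⁻¹ ^ (2 * k) : ℝ≥0) : ℝ≥0∞)) ≤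
      ((κ ^ k : ℝ≥0) : ℝ≥0∞) * (∫⁻ y, ‖h y‖ₑ ∂νG) * eLpNorm u 2 (μ.withDensity fun x => (((supHeight F E c N x)⁻¹ ^ (2 * k) : ℝ≥0) : ℝ≥0∞)) := by
  rw [eLpNorm_two_withDensity_weightX μ k (measurable_convX νG hhm hu), eLpNorm_two_withDensity_weightX μ k hu]
  have hmain := lintegral_weightX_mul_enorm_sq_conv_le νG μ hΩ hhm hh1 hsupp k hu
  calc (∫⁻ ξ, ((((supHeight F E c N ξ)⁻¹ ^ (2 * k) : ℝ≥0)) : ℝ≥0∞) * ‖∫ y, h y * u (y⁻¹ • ξ) ∂νG‖ₑ ^ 2 ∂μ) ^ (1 / 2 : ℝ)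
      ≤ (((κ ^ (2 * k) : ℝ≥0) : ℝ≥0∞) * (∫⁻ y, ‖h y‖ₑ ∂νG) ^ 2 * ∫⁻ ξ, ((((supHeight F E c N ξ)⁻¹ ^ (2 * k) : ℝ≥0)) : ℝ≥0∞) * ‖u ξ‖ₑ ^ 2 ∂μ) ^ (1 / 2 : ℝ) :=
        ENNReal.rpow_le_rpow hmain (by norm_num)
    _ = ((κ ^ k : ℝ≥0) : ℝ≥0∞) * (∫⁻ y, ‖h y‖ₑ ∂νG) * (∫⁻ ξ, ((((supHeight F E c N ξ)⁻¹ ^ (2 * k) : ℝ≥0)) : ℝ≥0∞) * ‖u ξ‖ₑ ^ 2 ∂μ) ^ (1 / 2 : ℝ) := by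
        have hsq : ((κ ^ (2 * k) : ℝ≥0) : ℝ≥0∞) * (∫⁻ y, ‖h y‖ₑ ∂νG) ^ 2 = (((κ ^ k : ℝ≥0) : ℝ≥0∞) * ∫⁻ y, ‖h y‖ₑ ∂νG) ^ 2 := by
          rw [mul_pow, ← ENNReal.coe_pow, ← pow_mul, mul_comm k 2]
        rw [hsq, ENNReal.mul_rpow_of_nonneg _ _ (by norm_num : (0 : ℝ) ≤ 1 / 2), ← ENNReal.rpow_natCast, ← ENNReal.rpow_mul]
        norm_num

/-- **`R(h)u ∈ 𝓗_k(𝔛)` for `u ∈ 𝓗_k(𝔛)`.** [cite: BernsteinLapid2019, §4 p. 10] -/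
theorem memLp_convX [SFinite νG] [SFinite μ] {Ω : Set (quasiSplit F E c N).Adelic} {κ : ℝ≥0}
    (hΩ : ∀ ξ : (quasiSplit F E c N).automorphicQuotient, ∀ y ∈ Ω, supHeight F E c N (y⁻¹ • ξ) ≤ κ * supHeight F E c N ξ ∧ supHeight F E c N ξ ≤ κ * supHeight F E c N (y⁻¹ • ξ))
    {h : (quasiSplit F E c N).Adelic → ℂ} (hhm : Measurable h) (hh1 : ∫⁻ y, ‖h y‖ₑ ∂νG ≠ ∞) (hsupp : ∀ y, y ∉ Ω → h y = 0) (u : HX F E c N k μ) :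
    MemLp (fun ξ => ∫ y, h y * (u : (quasiSplit F E c N).automorphicQuotient → ℂ) (y⁻¹ • ξ) ∂νG) 2
      (μ.withDensity fun x => (((supHeight F E c N x)⁻¹ ^ (2 * k) : ℝ≥0) : ℝ≥0∞)) := by
  have hum : Measurable (u : (quasiSplit F E c N).automorphicQuotient → ℂ) := (Lp.stronglyMeasurable u).measurable
  refine ⟨(measurable_convX νG hhm hum).aestronglyMeasurable, lt_of_le_of_lt (eLpNorm_convX_le νG μ k hΩ hhm hh1 hsupp hum) ?_⟩
  exact ENNReal.mul_lt_top (ENNReal.mul_lt_top ENNReal.coe_lt_top hh1.lt_top) (Lp.eLpNorm_lt_top u)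

end Estimate

/-! ## §2 THE OPERATOR `T_X` -/

section Operator

variable [MeasurableSpace (quasiSplit F E c N).Adelic] [BorelSpace (quasiSplit F E c N).Adelic]
  (νG : Measure (quasiSplit F E c N).Adelic) (μ : Measure (quasiSplit F E c N).automorphicQuotient) (k : ℕ)
  [SMulInvariantMeasure (quasiSplit F E c N).Adelic (quasiSplit F E c N).automorphicQuotient μ]

/-- **`T_X = R(h)` ON `𝓗_k(𝔛)` EXISTS, IS a.e. THE CONVOLUTION, AND `‖T_X u‖ ≤ κ^k·‖h‖₁·‖u‖`** (dealer 09:18:31Z (a)).  Letters: `νG`, `μ` s-finite, `μ` invariant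
(`SMulInvariantMeasure`); the two-sided comparison `w₁(y⁻¹•ξ) ≍ w₁(ξ)` on `Ω` by `κ` (★ part 1 `exists_supHeight_inv_smul_le_of_isCompact` for `Ω` compact); `h` measurable, integrable,
`= 0` off `Ω`. [cite: BernsteinLapid2019, §4 p. 10] [cite: Folland1999, Thm. 6.18] -/
theorem exists_shiftOperatorX [SFinite νG] [SFinite μ] {Ω : Set (quasiSplit F E c N).Adelic} {κ : ℝ≥0}
    (hΩ : ∀ ξ : (quasiSplit F E c N).automorphicQuotient, ∀ y ∈ Ω, supHeight F E c N (y⁻¹ • ξ) ≤ κ * supHeight F E c N ξ ∧ supHeight F E c N ξ ≤ κ * supHeight F E c N (y⁻¹ • ξ))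
    {h : (quasiSplit F E c N).Adelic → ℂ} (hhm : Measurable h) (hh : Integrable h νG) (hsupp : ∀ y, y ∉ Ω → h y = 0) :
    ∃ T : HX F E c N k μ →L[ℂ] HX F E c N k μ,
      (∀ u : HX F E c N k μ, (T u : (quasiSplit F E c N).automorphicQuotient → ℂ) =ᵐ[μ.withDensity fun x => (((supHeight F E c N x)⁻¹ ^ (2 * k) : ℝ≥0) : ℝ≥0∞)]
        fun ξ => ∫ y, h y * (u : (quasiSplit F E c N).automorphicQuotient → ℂ) (y⁻¹ • ξ) ∂νG) ∧
      ∀ u : HX F E c N k μ, ‖T u‖ ≤ ((κ ^ k : ℝ≥0) : ℝ) * (∫⁻ y, ‖h y‖ₑ ∂νG).toReal * ‖u‖ := by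
  have hh1 : ∫⁻ y, ‖h y‖ₑ ∂νG ≠ ∞ := hh.2.ne
  have hmem : ∀ u : HX F E c N k μ, MemLp (fun ξ => ∫ y, h y * (u : (quasiSplit F E c N).automorphicQuotient → ℂ) (y⁻¹ • ξ) ∂νG) 2
      (μ.withDensity fun x => (((supHeight F E c N x)⁻¹ ^ (2 * k) : ℝ≥0) : ℝ≥0∞)) := fun u => memLp_convX νG μ k hΩ hhm hh1 hsupp u
  have hfin : ∀ u : HX F E c N k μ, ∫⁻ ξ, ((((supHeight F E c N ξ)⁻¹ ^ (2 * k) : ℝ≥0)) : ℝ≥0∞) * ‖(u : (quasiSplit F E c N).automorphicQuotient → ℂ) ξ‖ₑ ^ 2 ∂μ ≠ ∞ := by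
    intro u
    have h2 := Lp.eLpNorm_lt_top u
    rw [eLpNorm_two_withDensity_weightX μ k (Lp.stronglyMeasurable u).measurable] at h2
    intro htop
    rw [htop, ENNReal.top_rpow_of_pos (by norm_num : (0 : ℝ) < 1 / 2)] at h2
    exact lt_irrefl _ h2
  have hint : ∀ u : HX F E c N k μ, ∀ᵐ ξ ∂μ, Integrable (fun y => h y * (u : (quasiSplit F E c N).automorphicQuotient → ℂ) (y⁻¹ • ξ)) νG :=
    fun u => ae_integrable_mul_comp_inv_smul νG μ hΩ hhm hh hsupp k (Lp.stronglyMeasurable u).measurable (hfin u)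
  have hadd : ∀ u u' : HX F E c N k μ, (hmem (u + u')).toLp _ = (hmem u).toLp _ + (hmem u').toLp _ := by
    intro u u'
    rw [← MemLp.toLp_add (hmem u) (hmem u')]
    refine MemLp.toLp_congr _ _ ((ae_withDensity_weightX_iff μ k).2 ?_)
    have h1 := convX_congr_ae νG μ h ((ae_withDensity_weightX_iff μ k).1 (Lp.coeFn_add u u'))
    filter_upwards [h1, hint u, hint u'] with ξ hξ hξu hξu'
    rw [hξ, Pi.add_apply, ← integral_add hξu hξu']
    exact integral_congr_ae (Eventually.of_forall fun y => by simp only [Pi.add_apply]; ring)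
  have hsmul : ∀ (a : ℂ) (u : HX F E c N k μ), (hmem (a • u)).toLp _ = a • (hmem u).toLp _ := by
    intro a u
    rw [← MemLp.toLp_const_smul]
    refine MemLp.toLp_congr _ _ ((ae_withDensity_weightX_iff μ k).2 ?_)
    have h1 := convX_congr_ae νG μ h ((ae_withDensity_weightX_iff μ k).1 (Lp.coeFn_smul a u))
    filter_upwards [h1] with ξ hξ
    rw [hξ, Pi.smul_apply, smul_eq_mul, ← integral_const_mul]
    exact integral_congr_ae (Eventually.of_forall fun y => by simp only [Pi.smul_apply, smul_eq_mul]; ring)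
  set C : ℝ := ((κ ^ k : ℝ≥0) : ℝ) * (∫⁻ y, ‖h y‖ₑ ∂νG).toReal with hC
  let L : HX F E c N k μ →ₗ[ℂ] HX F E c N k μ :=
    { toFun := fun u => (hmem u).toLp _
      map_add' := hadd
      map_smul' := hsmul }
  have hbound : ∀ u : HX F E c N k μ, ‖L u‖ ≤ C * ‖u‖ := by
    intro u
    change ‖(hmem u).toLp _‖ ≤ C * ‖u‖
    rw [Lp.norm_toLp, Lp.norm_def, hC, ← ENNReal.coe_toReal (κ ^ k), ← ENNReal.toReal_mul, ← ENNReal.toReal_mul]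
    exact ENNReal.toReal_mono (ENNReal.mul_ne_top (ENNReal.mul_ne_top ENNReal.coe_ne_top hh1) (Lp.eLpNorm_lt_top u).ne)
      (eLpNorm_convX_le νG μ k hΩ hhm hh1 hsupp (Lp.stronglyMeasurable u).measurable)
  refine ⟨L.mkContinuous C hbound, fun u => ?_, fun u => ?_⟩
  · exact (hmem u).coeFn_toLp
  · exact (L.mkContinuous_apply C hbound u).symm ▸ hbound u

/-- **`T_X` FOR `h` SUPPORTED IN A COMPACT SET** (`κ = κ_Ω` of ★ FILE A, `w₁`-comparison by ★ part 1 §2). [cite: BernsteinLapid2019, §4 p. 10] -/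
theorem exists_shiftOperatorX_of_isCompact [SFinite νG] [SFinite μ] {Ω : Set (quasiSplit F E c N).Adelic} (hΩc : IsCompact Ω) :
    ∃ κ : ℝ≥0, 1 ≤ κ ∧ ∀ (h : (quasiSplit F E c N).Adelic → ℂ), Measurable h → Integrable h νG → (∀ y, y ∉ Ω → h y = 0) →
      ∃ T : HX F E c N k μ →L[ℂ] HX F E c N k μ,
        (∀ u : HX F E c N k μ, (T u : (quasiSplit F E c N).automorphicQuotient → ℂ) =ᵐ[μ.withDensity fun x => (((supHeight F E c N x)⁻¹ ^ (2 * k) : ℝ≥0) : ℝ≥0∞)]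
          fun ξ => ∫ y, h y * (u : (quasiSplit F E c N).automorphicQuotient → ℂ) (y⁻¹ • ξ) ∂νG) ∧
        ∀ u : HX F E c N k μ, ‖T u‖ ≤ ((κ ^ k : ℝ≥0) : ℝ) * (∫⁻ y, ‖h y‖ₑ ∂νG).toReal * ‖u‖ := by
  obtain ⟨κ, hκ1, hκ⟩ := exists_supHeight_inv_smul_le_of_isCompact hΩc
  exact ⟨κ, hκ1, fun h hhm hh hsupp => exists_shiftOperatorX νG μ k hκ hhm hh hsupp⟩

end Operator

/-! ## §3 THE INTERTWINING `δ(h) ∘ ι = restr ∘ ι ∘ T_X` -/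

section Intertwining

variable [MeasurableSpace (quasiSplit F E c N).Adelic] [BorelSpace (quasiSplit F E c N).Adelic]
  (νG : Measure (quasiSplit F E c N).Adelic) (μ : Measure (quasiSplit F E c N).automorphicQuotient) (μZ : Measure (borelQuotient F E c N))

omit [NeZero N] [MeasurableSpace (quasiSplit F E c N).Adelic] [BorelSpace (quasiSplit F E c N).Adelic] in
/-- **`p(z·y) = y⁻¹ • p(z)`** (`p[g] = [g⁻¹]`, `[g]·y = [g·y]`, `(g·y)⁻¹ = y⁻¹·g⁻¹`, `y⁻¹ • [x] = [y⁻¹·x]`). [cite: BernsteinLapid2019, §4 p. 10] -/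
theorem pZX_rightShift (y : (quasiSplit F E c N).Adelic) (z : borelQuotient F E c N) : pZX F E c N (rightShift F E c N y z) = y⁻¹ • pZX F E c N z := by
  induction z using Quotient.inductionOn with
  | h g =>
    change pZX F E c N (toBorelQuotient F E c N (g * y)) = y⁻¹ • pZX F E c N (toBorelQuotient F E c N g)
    rw [pZX_toBorelQuotient, pZX_toBorelQuotient, _root_.mul_inv_rev]
    rfl

omit [NeZero N] [BorelSpace (quasiSplit F E c N).Adelic] in
/-- **POINTWISE INTERTWINING**: `R_Z(h)(u ∘ p) = (R_X(h) u) ∘ p`. [cite: BernsteinLapid2019, §4 p. 10] -/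
theorem rightConvFun_comp_pZX (h : (quasiSplit F E c N).Adelic → ℂ) (u : (quasiSplit F E c N).automorphicQuotient → ℂ) (z : borelQuotient F E c N) :
    rightConvFun F E c N νG h (fun z' => u (pZX F E c N z')) z = ∫ y, h y * u (y⁻¹ • pZX F E c N z) ∂νG := by
  simp only [rightConvFun, pZX_rightShift]

/-- **THE INTERTWINING `δ(h) ∘ ι = restr ∘ ι ∘ T_X`** (the letter `hδι` of ★ G-c `K2E1BLXSystemPackage`).  Letters: `hs : ShiftBound k c₁ c₀ νG μZ h` (★ P3 B2 `shiftBound`),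
`hb : IotaBound k c₁ μ μZ` (★ P2a-ι), `h01 : c₁ ≤ c₀`, ANY `T_X : 𝓗_k(𝔛) →L 𝓗_k(𝔛)` with `T_X u =ᵐ R_X(h)u` (§2), and the letters under which `R_Z(h)` respects a.e.-equality on `Z`
(★ B1: `νG`, `μZ` s-finite, `hright`, `Ω` measurable with `HZ(z) ≤ κ·HZ(z·y)` on `Ω`, `κ > 0`, `κ·c₁ ≤ c₀`, `h = 0` off `Ω`). [cite: BernsteinLapid2019, §4 p. 10] -/
theorem deltaShift_comp_iota [SFinite νG] [SFinite μZ] {k : ℕ} {c₁ c₀ : ℝ≥0} {h : (quasiSplit F E c N).Adelic → ℂ}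
    (hs : ShiftBound F E c N k c₁ c₀ νG μZ h) (hb : IotaBound F E c N k c₁ μ μZ) (h01 : c₁ ≤ c₀)
    (hright : ∀ y, MeasurePreserving (rightShift F E c N y) μZ μZ) {Ω : Set (quasiSplit F E c N).Adelic} (hΩm : MeasurableSet Ω) {κ : ℝ≥0} (hκ : 0 < κ) (hc : κ * c₁ ≤ c₀)
    (hΩ : ∀ z : borelQuotient F E c N, ∀ y ∈ Ω, borelQuotHeight F E c N z ≤ κ * borelQuotHeight F E c N (rightShift F E c N y z)) (hsupp : ∀ y, y ∉ Ω → h y = 0)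
    (T : HX F E c N k μ →L[ℂ] HX F E c N k μ)
    (hT : ∀ u : HX F E c N k μ, (T u : (quasiSplit F E c N).automorphicQuotient → ℂ) =ᵐ[μ.withDensity fun x => (((supHeight F E c N x)⁻¹ ^ (2 * k) : ℝ≥0) : ℝ≥0∞)]
      fun ξ => ∫ y, h y * (u : (quasiSplit F E c N).automorphicQuotient → ℂ) (y⁻¹ • ξ) ∂νG) :
    (deltaShift hs).comp (iota hb) = (restrHN F E c N k h01 μZ).comp ((iota hb).comp T) := by
  refine ContinuousLinearMap.ext fun u => Lp.ext ?_
  rw [ContinuousLinearMap.comp_apply, ContinuousLinearMap.comp_apply, ContinuousLinearMap.comp_apply]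
  -- LHS: `δ(h)(ι u) =ᵐ[w₀] R_Z(h)(⇑(ι u)) =ᵐ[w₀] R_Z(h)(⇑u ∘ p) = (R_X(h)⇑u) ∘ p`
  have hL1 := deltaShift_spec hs (iota hb u)
  have hι : ((iota hb u : HN F E c N k c₁ μZ) : borelQuotient F E c N → ℂ) =ᵐ[μZ.restrict {z | c₁ < borelQuotHeight F E c N z}]
      fun z => (u : (quasiSplit F E c N).automorphicQuotient → ℂ) (pZX F E c N z) :=
    (ae_weightedTruncMeasure_iff μZ k c₁).1 (coeFn_iota hb u)
  have hL2 : rightConvFun F E c N νG h ((iota hb u : HN F E c N k c₁ μZ) : borelQuotient F E c N → ℂ) =ᵐ[weightedTruncMeasure F E c N k c₀ μZ]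
      rightConvFun F E c N νG h (fun z => (u : (quasiSplit F E c N).automorphicQuotient → ℂ) (pZX F E c N z)) :=
    (ae_weightedTruncMeasure_iff μZ k c₀).2 (rightConvFun_congr_ae_restrict νG μZ hright hΩm hκ hc hΩ hsupp hι)
  -- RHS: `restr (ι (T u)) =ᵐ[w₀] ⇑(ι (T u)) =ᵐ ⇑(T u) ∘ p =ᵐ (R_X(h)⇑u) ∘ p`
  have hR1 : ((restrHN F E c N k h01 μZ (iota hb (T u)) : HN F E c N k c₀ μZ) : borelQuotient F E c N → ℂ) =ᵐ[weightedTruncMeasure F E c N k c₀ μZ]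
      ((iota hb (T u) : HN F E c N k c₁ μZ) : borelQuotient F E c N → ℂ) := by
    rw [restrHN_apply]
    exact (memLp_restrict F E c N k h01 μZ _).coeFn_toLp
  have hR2 : ((iota hb (T u) : HN F E c N k c₁ μZ) : borelQuotient F E c N → ℂ) =ᵐ[weightedTruncMeasure F E c N k c₁ μZ]
      fun z => ∫ y, h y * (u : (quasiSplit F E c N).automorphicQuotient → ℂ) (y⁻¹ • pZX F E c N z) ∂νG := by
    filter_upwards [coeFn_iota hb (T u), hb.1.ae_eq (hT u)] with z hz hz'
    rw [hz]
    exact hz'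
  have hR2' := (weightedTruncMeasure_absolutelyContinuous F E c N k h01 μZ).ae_le hR2
  -- assemble
  filter_upwards [hL1, hL2, hR1, hR2'] with z h1 h2 h3 h4
  rw [h1, h2, rightConvFun_comp_pZX, h3, h4]

end Intertwining

end Summit.HodgeConjecture.HodgeConjecture.Cruxes.H413.K2E1BLHeckeOperatorHXU2Op

end
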